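import Summits.NavierStokesRegularity.NavierStokesRegularity.Theses.PerpetualPump

/-!
# NavierStokesRegularity — route `PerpetualPump`, assembly

Settles `stmt-NavierStokesRegularity-1833` (assembly of route PerpetualPump):

  `Thesis → EulerTypeIGlue → NoTypeII → NoBlowupToClay → NavierStokesRegularity`

(all four hypotheses inlined in the route decl `PerpetualPump.Assembly`). The hypothesis list is,
in the same order, the hypothesis list of the route's deciding theorem
`Summit.NavierStokesRegularity.NavierStokesRegularity.Theses.PerpetualPump.closes`; the proof below
is the same pure logic, written out so that it does not depend on that theorem:
`NoBlowupToClay` reduces Clay (A) to "every finite-energy classical solution on `[0,T)` from a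
rapidly decaying datum extends smoothly past `T`"; if such a solution `(u,p)` had no smooth
extension past `T` it would be a maximal smooth solution with lifespan `T`
(`Literature.Analysis.FluidPDE.IsMaximalSmoothSolution` is by definition
`IsClassicalNSSolutionOn (Ico 0 T) ∧ ¬ HasSmoothExtensionPast`), so `NoTypeII` gives the Type-I
rate `IsTypeIBlowup u T`, and then `EulerTypeIGlue` fed with `Thesis` produces a smooth extension
past `T` — contradiction. Nothing here is new mathematics; the open content lives in the cruxes
`Thesis` (predicted false by the route card) and `NoTypeII`.
-/

namespace Summit.NavierStokesRegularity.NavierStokesRegularity.Theorems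

open Summit.NavierStokesRegularity.NavierStokesRegularity.Theses

/-- Assembly of route PerpetualPump (`stmt-NavierStokesRegularity-1833`):
`Thesis → EulerTypeIGlue → NoTypeII → NoBlowupToClay → NavierStokesRegularity`. Pure logic: apply
`NoBlowupToClay`; a classical Leray–Hopf solution from a rapidly decaying datum with no smooth
extension past `T` is maximal (`IsMaximalSmoothSolution = classical ∧ ¬ HasSmoothExtensionPast`),
`NoTypeII` makes it Type I, and `EulerTypeIGlue` + `Thesis` extend it past `T`, contradiction.
[folklore] -/
theorem perpetualPump_assembly_proof : PerpetualPump.Assembly := by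
  unfold PerpetualPump.Assembly
  intro hT hG hII hClay
  apply hClay
  intro ν T hν hTpos u p hcl hLH hdec
  by_contra hext
  have hTI : Literature.Analysis.FluidPDE.IsTypeIBlowup u T :=
    hII ν T hν hTpos u p ⟨hcl, hext⟩ hLH hdec
  exact hext (hG hT ν T hν hTpos u p hcl hLH hdec hTI)

end Summit.NavierStokesRegularity.NavierStokesRegularity.Theorems
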